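import Mathlib.RingTheory.PowerSeries.Exp
import Literature.NumberTheory.Sieve.ParityBarrierProofs

/-!
# The generalised von Mangoldt functions at coprime arguments

Topic `Literature/NumberTheory/Sieve`, companion file of `ParityBarrier.lean` /
`ParityBarrierProofs.lean` (`Literature.generalizedVonMangoldt k = Λ_k = μ ⋆ log^k`). PROVED here:

* `generalizedVonMangoldt_apply'` — `Λ_k(n) = ∑_{de = n} μ(d) (log e)^k` for ALL `k`
  (the tree's `generalizedVonMangoldt_apply` needs `k ≥ 1`; for `k = 0` both sides are
  `∑_{d ∣ n} μ(d) = [n = 1]`);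
* `generalizedVonMangoldt_zero_apply` — `Λ_0(n) = [n = 1]`;
* **`generalizedVonMangoldt_mul_of_coprime`** — the Leibniz-type rule
  `Λ_k(ab) = ∑_{i+j = k} (k choose i) Λ_i(a) Λ_j(b)` for `(a, b) = 1`
  (Bombieri, *The asymptotic sieve* §1; Friedlander–Iwaniec, *Opera de Cribro*, (3.6)–(3.8):
  `Λ_k` is not multiplicative, but its exponential generating function is), also in the
  `range (k+1)` form `generalizedVonMangoldt_mul_of_coprime'`;
* `generalizedVonMangoldt_mul_le_of_coprime` — the consequence used by sieve bounds: for
  `(a, b) = 1`, `b > 1`, `Λ_k(ab) ≤ ∑_{j < k} (k choose j) Λ_j(a) (log b)^{k−j}` (the term `j = k`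
  vanishes since `Λ_0(b) = 0`, and `Λ_{k−j}(b) ≤ (log b)^{k−j}`).

Method (a formalisation device, [folklore]): the arithmetic function with values in the formal
power series ring `ℝ⟦X⟧`, `E(n) = exp(X log n) = ∑_k (log n)^k X^k / k!` (Mathlib's
`PowerSeries.rescale (log n) (PowerSeries.exp ℝ)`), is multiplicative — indeed completely, by
`PowerSeries.exp_mul_exp_eq_exp_add` — hence so is `F = μ ⋆ E`
(`ArithmeticFunction.IsMultiplicative.mul`), and the `X^k`-coefficient of `F(n)` is `Λ_k(n)/k!`.
Comparing the `X^k`-coefficients of `F(ab) = F(a) F(b)` gives the rule.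
-/

open Finset ArithmeticFunction
open scoped ArithmeticFunction.Moebius ArithmeticFunction.zeta ArithmeticFunction.vonMangoldt
open scoped Nat

noncomputable section

namespace Literature.NumberTheory.Sieve

/-! ### `Λ_k(n)` as a divisor sum, all `k` -/

/-- `Λ_k(n) = ∑_{de = n} μ(d) (log e)^k` for every `k ≥ 0` (for `k = 0`, Mathlib's `ppow f 0 = ζ`
and `ζ(e) = 1 = (log e)^0` for `e ≥ 1`). [folklore] -/
theorem generalizedVonMangoldt_apply' (k n : ℕ) :
    generalizedVonMangoldt k n =
      ∑ x ∈ n.divisorsAntidiagonal, (μ x.1 : ℝ) * Real.log x.2 ^ k := by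
  rcases Nat.eq_zero_or_pos k with rfl | hk
  · rw [generalizedVonMangoldt, ppow_zero, mul_apply]
    refine Finset.sum_congr rfl fun x hx => ?_
    have hx2 : x.2 ≠ 0 := (Nat.mem_divisorsAntidiagonal.mp hx |>.1 ▸
      (Nat.mem_divisorsAntidiagonal.mp hx).2) |> fun h h2 => h (by rw [h2, mul_zero])
    rw [intCoe_apply, natCoe_apply, zeta_apply, if_neg hx2, pow_zero, Nat.cast_one]
  · exact generalizedVonMangoldt_apply hk n

/-- `Λ_0(n) = [n = 1]` (`Λ_0 = μ ⋆ ζ = δ`). [folklore] -/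
theorem generalizedVonMangoldt_zero_apply (n : ℕ) :
    generalizedVonMangoldt 0 n = if n = 1 then 1 else 0 := by
  rw [generalizedVonMangoldt_zero, one_apply]

/-! ### The exponential generating function `E(n) = exp(X log n)` -/

/-- `E(n) = exp(X log n) ∈ ℝ⟦X⟧` for `n ≥ 1`, `E(0) = 0`: the exponential generating function of
the powers of `log n`. A formalisation device. [folklore] -/
def expLog : ArithmeticFunction (PowerSeries ℝ) where
  toFun n := if n = 0 then 0 else PowerSeries.rescale (Real.log n) (PowerSeries.exp ℝ)
  map_zero' := if_pos rfl

/-- Unfolding lemma (definition). [folklore] -/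
theorem expLog_apply {n : ℕ} (hn : n ≠ 0) :
    expLog n = PowerSeries.rescale (Real.log n) (PowerSeries.exp ℝ) :=
  if_neg hn

/-- The `X^k`-coefficient of `E(n)` is `(log n)^k / k!`. [folklore] -/
theorem coeff_expLog {n : ℕ} (hn : n ≠ 0) (k : ℕ) :
    PowerSeries.coeff k (expLog n) = Real.log n ^ k * ((k ! : ℝ))⁻¹ := by
  rw [expLog_apply hn, PowerSeries.coeff_rescale, PowerSeries.coeff_exp, one_div, map_inv₀,
    map_natCast]

/-- `E` is multiplicative (indeed `E(mn) = E(m) E(n)` for all `m, n ≥ 1`, by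
`exp(X(u+v)) = exp(Xu) exp(Xv)`, Mathlib's `PowerSeries.exp_mul_exp_eq_exp_add`). [folklore] -/
theorem isMultiplicative_expLog : expLog.IsMultiplicative := by
  refine ⟨?_, ?_⟩
  · rw [expLog_apply one_ne_zero, Nat.cast_one, Real.log_one, PowerSeries.rescale_zero_apply,
      PowerSeries.constantCoeff_exp, map_one]
  · intro m n _
    by_cases hm : m = 0
    · subst hm; rw [zero_mul, ArithmeticFunction.map_zero, zero_mul]
    by_cases hn : n = 0
    · subst hn; rw [mul_zero, ArithmeticFunction.map_zero, mul_zero]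
    rw [expLog_apply (mul_ne_zero hm hn), expLog_apply hm, expLog_apply hn, Nat.cast_mul,
      Real.log_mul (by exact_mod_cast hm) (by exact_mod_cast hn),
      PowerSeries.exp_mul_exp_eq_exp_add]

/-- `F = μ ⋆ E`, the exponential generating function of the `Λ_k`. A formalisation device.
[folklore] -/
def moebiusExpLog : ArithmeticFunction (PowerSeries ℝ) :=
  (μ : ArithmeticFunction (PowerSeries ℝ)) * expLog

/-- `F = μ ⋆ E` is multiplicative. [folklore] -/
theorem isMultiplicative_moebiusExpLog : moebiusExpLog.IsMultiplicative :=
  isMultiplicative_moebius.intCast.mul isMultiplicative_expLog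

/-- The `X^k`-coefficient of `F(n)` is `Λ_k(n) / k!`. [folklore] -/
theorem coeff_moebiusExpLog (k n : ℕ) :
    PowerSeries.coeff k (moebiusExpLog n) = generalizedVonMangoldt k n * ((k ! : ℝ))⁻¹ := by
  rw [moebiusExpLog, mul_apply, map_sum, generalizedVonMangoldt_apply', Finset.sum_mul]
  refine Finset.sum_congr rfl fun x hx => ?_
  have hx2 : x.2 ≠ 0 := by
    intro h2
    have h := Nat.mem_divisorsAntidiagonal.mp hx
    exact h.2 (by rw [← h.1, h2, mul_zero])
  rw [intCoe_apply, show ((μ x.1 : ℤ) : PowerSeries ℝ) = PowerSeries.C ((μ x.1 : ℤ) : ℝ) by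
      rw [map_intCast], PowerSeries.coeff_C_mul, coeff_expLog hx2, mul_assoc]

/-! ### The rule at coprime arguments -/

/-- **`Λ_k` at coprime arguments** (Bombieri 1976 §1; Friedlander–Iwaniec, *Opera de Cribro*,
§3.1): for `(a, b) = 1`,
`Λ_k(ab) = ∑_{i + j = k} (k choose i) Λ_i(a) Λ_j(b)`.
Proof: compare the `X^k`-coefficients of `F(ab) = F(a) F(b)`, `F = μ ⋆ exp(X log ·)`
(`isMultiplicative_moebiusExpLog`, `coeff_moebiusExpLog`), and clear the factorials
(`(i+j)! = (i+j choose i) · i! · j!`). [folklore] -/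
theorem generalizedVonMangoldt_mul_of_coprime {a b : ℕ} (hab : a.Coprime b) (k : ℕ) :
    generalizedVonMangoldt k (a * b) =
      ∑ ij ∈ antidiagonal k,
        (k.choose ij.1 : ℝ) * (generalizedVonMangoldt ij.1 a * generalizedVonMangoldt ij.2 b) := by
  have hmul := isMultiplicative_moebiusExpLog.map_mul_of_coprime hab
  have hcoeff := congrArg (PowerSeries.coeff k) hmul
  rw [PowerSeries.coeff_mul, coeff_moebiusExpLog] at hcoeff
  simp only [coeff_moebiusExpLog] at hcoeff
  have hk : ((k ! : ℝ)) ≠ 0 := by exact_mod_cast (Nat.factorial_pos k).ne'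
  -- multiply through by `k!`
  have h2 := congrArg (fun t => t * (k ! : ℝ)) hcoeff
  simp only [inv_mul_cancel_right₀ hk, Finset.sum_mul] at h2
  rw [h2]
  refine Finset.sum_congr rfl fun ij hij => ?_
  have hijk : ij.1 + ij.2 = k := mem_antidiagonal.mp hij
  have hle : ij.1 ≤ k := hijk ▸ Nat.le_add_right _ _
  have hnat := Nat.choose_mul_factorial_mul_factorial hle
  have hsub : k - ij.1 = ij.2 := by omega
  rw [hsub] at hnat
  have hfac : ((k ! : ℝ)) = (k.choose ij.1 : ℝ) * (ij.1 ! : ℝ) * (ij.2 ! : ℝ) := by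
    exact_mod_cast hnat.symm
  have hi : ((ij.1 ! : ℝ)) ≠ 0 := by exact_mod_cast (Nat.factorial_pos _).ne'
  have hj : ((ij.2 ! : ℝ)) ≠ 0 := by exact_mod_cast (Nat.factorial_pos _).ne'
  calc generalizedVonMangoldt ij.1 a * ((ij.1 ! : ℝ))⁻¹ *
        (generalizedVonMangoldt ij.2 b * ((ij.2 ! : ℝ))⁻¹) * (k ! : ℝ)
      = (k.choose ij.1 : ℝ) * (generalizedVonMangoldt ij.1 a * generalizedVonMangoldt ij.2 b) *
          (((ij.1 ! : ℝ))⁻¹ * (ij.1 ! : ℝ)) * (((ij.2 ! : ℝ))⁻¹ * (ij.2 ! : ℝ)) := by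
        rw [hfac]; ring
    _ = _ := by rw [inv_mul_cancel₀ hi, inv_mul_cancel₀ hj, mul_one, mul_one]

/-- The rule at coprime arguments in the form `Λ_k(ab) = ∑_{j ≤ k} (k choose j) Λ_j(a) Λ_{k−j}(b)`.
[folklore] -/
theorem generalizedVonMangoldt_mul_of_coprime' {a b : ℕ} (hab : a.Coprime b) (k : ℕ) :
    generalizedVonMangoldt k (a * b) =
      ∑ j ∈ range (k + 1),
        (k.choose j : ℝ) * (generalizedVonMangoldt j a * generalizedVonMangoldt (k - j) b) := by
  rw [generalizedVonMangoldt_mul_of_coprime hab k]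
  exact Finset.Nat.sum_antidiagonal_eq_sum_range_succ_mk
    (fun ij : ℕ × ℕ => (k.choose ij.1 : ℝ) *
      (generalizedVonMangoldt ij.1 a * generalizedVonMangoldt ij.2 b)) k

/-- **Upper bound at coprime arguments**: for `(a, b) = 1` and `b > 1`,
`Λ_k(ab) ≤ ∑_{j < k} (k choose j) Λ_j(a) (log b)^{k−j}`: in the rule
`generalizedVonMangoldt_mul_of_coprime'` the term `j = k` carries `Λ_0(b) = [b = 1] = 0`, and
`0 ≤ Λ_{k−j}(b) ≤ (log b)^{k−j}` for `j < k` (`generalizedVonMangoldt_le`), `Λ_j(a) ≥ 0`. [folklore] -/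
theorem generalizedVonMangoldt_mul_le_of_coprime {a b : ℕ} (hab : a.Coprime b) (hb : 1 < b)
    (k : ℕ) :
    generalizedVonMangoldt k (a * b) ≤
      ∑ j ∈ range k, (k.choose j : ℝ) * generalizedVonMangoldt j a * Real.log b ^ (k - j) := by
  rw [generalizedVonMangoldt_mul_of_coprime' hab k, Finset.sum_range_succ, Nat.sub_self,
    generalizedVonMangoldt_zero_apply, if_neg hb.ne', mul_zero, mul_zero, add_zero]
  refine Finset.sum_le_sum fun j hj => ?_
  have hjk : 0 < k - j := Nat.sub_pos_of_lt (Finset.mem_range.mp hj)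
  rw [mul_assoc]
  refine mul_le_mul_of_nonneg_left ?_ (Nat.cast_nonneg _)
  exact mul_le_mul_of_nonneg_left (generalizedVonMangoldt_le hjk b)
    (generalizedVonMangoldt_nonneg j a)

end Literature.NumberTheory.Sieve
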